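import Literature.MathematicalPhysics.QuantumFieldTheory.ConformalBootstrap3D.SL2BlockCoefficients
import Mathlib.Tactic
import HarnessLib

/-!
# Dimensional reduction `3 → 2` with spin: the rational identities

Pure real-variable algebra for `DimensionalReductionSpin` (Hogervorst 2016 eqs. (2.24)/(2.35) at `d = 3`, all spins).
With `α` the half-twist, `m` the level and `(x, y)` (`x + y + 1 = ℓ`) the position across the band of the
lattice of products `k_{2(α+a)}(z) k_{2(α+b)}(z̄)`, Hogervorst's closed-form coefficient SEPARATES as
`G_m(x) G_m(y) E_m` (see `DimensionalReductionSpin`); here we record the step ratios `R` (`x ↦ x+1`), `S`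
(level `m ↦ m+1` in `G`), `e` (`E_{m+1}/E_m`), the reduced factors `A = S/R`, `B = γ/R`, and prove the three
rational identities to which the engine's odd-site relation (`DimensionalReduction3D.siteU`) reduces on the
closed form: the interior four-term identity (`spin_interior_identity`, in reduced form), the top-edge
two-term identity (`spin_top_identity`) and the level-`0` Legendre identity (`spin_legendre_identity`).
Everything is `field_simp; ring` after atomising the denominators; nothing is summed. Exact cross-checks in
rational arithmetic (also at non-integer `m, x, y`): pub-ising3d HOME `pub-ising3d-lit-g12/code/spin_identities.py`.

References: M. Hogervorst, JHEP 09 (2016) 017, §2 eqs. (2.24), (2.35); F. Dolan, H. Osborn, arXiv:1108.6194 §2 eq. (2.12).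
-/

namespace Literature.MathematicalPhysics.QuantumFieldTheory.ConformalBootstrap3D

section SpinIdentities

/-! ### Real-variable step factors and the three rational identities -/

/-- `x`-step factor of `G_m`: `G_m(x+1)/G_m(x)`. [folklore] -/
noncomputable def spinR (al m x : ℝ) : ℝ :=
  (2 * x + 1) * (al + x + m) * (al + x - 1 / 2) / ((2 * x + 2) * (al + x) * (al + x - 1 / 2 + m))

/-- level-step factor of `G_m(x)`: `G_{m+1}(x)/G_m(x)`. [folklore] -/
noncomputable def spinS (al m x : ℝ) : ℝ :=
  (al + x + m) / (al + x - 1 / 2 + m)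

/-- level-step factor of `E_m`: `E_{m+1}/E_m` (`Δ = 2α + ℓ`, `β = α + ℓ`). [folklore] -/
noncomputable def spinEr (al m l : ℝ) : ℝ :=
  (1 / 2 + m) * (2 * al + l - 1 + m) * (al + l + m) * (al - 1 / 2 + m) /
    (16 * (m + 1) * (2 * al + l - 1 / 2 + m) * (al + l + 1 / 2 + m) * (al + m))

/-- `μ` with real arguments: `μ(h_a,h_b) = h_a(h_a-1) + h_b(h_b-1) - c₃`, `c₃ = 2α² + 2αℓ - 3α + ℓ² - ℓ`
(`= ½[Δ(Δ-3)+ℓ(ℓ+1)]` at `Δ = 2α+ℓ`). [cite: DolanOsborn2011, §2 eq. (2.12)] -/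
noncomputable def spinMu (al l ha hb : ℝ) : ℝ :=
  ha * (ha - 1) + hb * (hb - 1) - (2 * al ^ 2 + 2 * al * l - 3 * al + l ^ 2 - l)

/-- Reduced `x`-factor `A_x = S_x / R_x = 2(2x+2)(α+x)/((2x+1)(2α+2x-1))` (level-independent). [folklore] -/
noncomputable def spinA (al x : ℝ) : ℝ :=
  2 * (2 * x + 2) * (al + x) / ((2 * x + 1) * (2 * al + 2 * x - 1))

/-- Reduced `γ`-factor `B_y = γ_{α+m+y} / R_y`. [folklore] -/
noncomputable def spinB (al m y : ℝ) : ℝ :=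
  (al + m + y) * (2 * y + 2) * (al + y) / (8 * (2 * y + 1) * (2 * al + 2 * y - 1) * (al + (y + 1) - 1 / 2 + m))

/-- `S_x = R_x A_x`. [folklore] -/
theorem spinS_eq_RA (al m x : ℝ) (hal : 1 / 2 < al) (hm : 0 ≤ m) (hx : 0 ≤ x) :
    spinS al m x = spinR al m x * spinA al x := by
  unfold spinS spinR spinA
  generalize e1 : al + x - 1 / 2 + m = d1
  generalize e2 : 2 * x + 2 = d2
  generalize e3 : al + x = d3
  generalize e4 : 2 * x + 1 = d4
  generalize e5 : 2 * al + 2 * x - 1 = d5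
  have f1 : d1 ≠ 0 := by rw [← e1]; intro h; linarith
  have f2 : d2 ≠ 0 := by rw [← e2]; intro h; linarith
  have f3 : d3 ≠ 0 := by rw [← e3]; intro h; linarith
  have f4 : d4 ≠ 0 := by rw [← e4]; intro h; linarith
  have f5 : d5 ≠ 0 := by rw [← e5]; intro h; linarith
  field_simp
  subst e1 e2 e3 e4 e5
  ring

/-- `γ_{α+m+y} = R_y B_y`. [folklore] -/
theorem sl2Gamma_eq_RB (al m y : ℝ) (hal : 1 / 2 < al) (hm : 0 ≤ m) (hy : 0 ≤ y) :
    sl2Gamma (al + (m + y)) = spinR al m y * spinB al m y := by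
  unfold sl2Gamma spinR spinB
  generalize e1 : al + (y + 1) - 1 / 2 + m = d1
  generalize e0 : al + y - 1 / 2 + m = d0
  generalize e2 : 2 * y + 2 = d2
  generalize e3 : al + y = d3
  generalize e4 : 2 * y + 1 = d4
  generalize e5 : 2 * al + 2 * y - 1 = d5
  generalize e6 : 2 * (al + (m + y)) - 1 = d6
  generalize e7 : 2 * (al + (m + y)) + 1 = d7
  have f1 : d1 ≠ 0 := by rw [← e1]; intro h; linarith
  have f0 : d0 ≠ 0 := by rw [← e0]; intro h; linarith
  have f2 : d2 ≠ 0 := by rw [← e2]; intro h; linarith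
  have f3 : d3 ≠ 0 := by rw [← e3]; intro h; linarith
  have f4 : d4 ≠ 0 := by rw [← e4]; intro h; linarith
  have f5 : d5 ≠ 0 := by rw [← e5]; intro h; linarith
  have f6 : d6 ≠ 0 := by rw [← e6]; intro h; linarith
  have f7 : d7 ≠ 0 := by rw [← e7]; intro h; linarith
  field_simp
  subst e1 e0 e2 e3 e4 e5 e6 e7
  ring

set_option maxHeartbeats 4000000 in
/-- **The interior identity, reduced form** (real variables; `ℓ = x + y + 1`; the common factor
`G_m(x) G_m(y) E_m R_x R_y / λ_ℓ` of the four lattice terms divided out):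
`A_x S_{y+1} e (μ₁ - h_{b+1}) + B_y (μ₃ + h_{b-1} - 1) = S_{x+1} A_y e (μ₂ - h_{a+1}) + B_x (μ₄ + h_{a-1} - 1)`.
[folklore] -/
theorem spin_interior_identity (al m x y : ℝ) (hal : 1 / 2 < al) (hm : 0 ≤ m) (hx : 0 ≤ x) (hy : 0 ≤ y) :
    spinA al x * spinS al m (y + 1) * spinEr al m (x + y + 1) *
        (spinMu al (x + y + 1) (al + m + 1 + x) (al + m + 2 + y) - (al + m + 2 + y))
      + spinB al m y * (spinMu al (x + y + 1) (al + m + 1 + x) (al + m + y) + (al + m + y) - 1) =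
    spinS al m (x + 1) * spinA al y * spinEr al m (x + y + 1) *
        (spinMu al (x + y + 1) (al + m + 2 + x) (al + m + 1 + y) - (al + m + 2 + x))
      + spinB al m x * (spinMu al (x + y + 1) (al + m + x) (al + m + 1 + y) + (al + m + x) - 1) := by
  unfold spinA spinS spinEr spinMu spinB
  generalize e7 : 2 * al + (x + y + 1) - 1 / 2 + m = d7
  generalize e8 : al + (x + y + 1) + 1 / 2 + m = d8
  generalize e5 : al + (y + 1) - 1 / 2 + m = d5
  generalize e6 : al + (x + 1) - 1 / 2 + m = d6
  generalize e1 : 2 * x + 1 = d1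
  generalize e2 : 2 * al + 2 * x - 1 = d2
  generalize e3 : 2 * y + 1 = d3
  generalize e4 : 2 * al + 2 * y - 1 = d4
  generalize e9 : al + m = d9
  generalize e10 : m + 1 = d10
  have f1 : d1 ≠ 0 := by rw [← e1]; intro h; linarith
  have f2 : d2 ≠ 0 := by rw [← e2]; intro h; linarith
  have f3 : d3 ≠ 0 := by rw [← e3]; intro h; linarith
  have f4 : d4 ≠ 0 := by rw [← e4]; intro h; linarith
  have f5 : d5 ≠ 0 := by rw [← e5]; intro h; linarith
  have f6 : d6 ≠ 0 := by rw [← e6]; intro h; linarith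
  have f7 : d7 ≠ 0 := by rw [← e7]; intro h; linarith
  have f8 : d8 ≠ 0 := by rw [← e8]; intro h; linarith
  have f9 : d9 ≠ 0 := by rw [← e9]; intro h; linarith
  have f10 : d10 ≠ 0 := by rw [← e10]; intro h; linarith
  field_simp
  subst e1 e2 e3 e4 e5 e6 e7 e8 e9 e10
  ring

set_option maxHeartbeats 4000000 in
/-- **The top-edge identity** (real variables). [folklore] -/
theorem spin_top_identity (al m l : ℝ) (hal : 1 / 2 < al) (hm : 0 ≤ m) (hl : 0 ≤ l) :
    spinS al m l * spinS al m 0 * spinEr al m l *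
        (spinMu al l (al + m + 1 + l) (al + m + 1) - (al + m + 1)) =
      (spinMu al l (al + m + l) (al + m) + (al + m + l) - 1) * sl2Gamma (al + m + l) := by
  unfold spinS spinEr spinMu sl2Gamma
  generalize e7 : 2 * al + l - 1 / 2 + m = d7
  generalize e8 : al + l + 1 / 2 + m = d8
  generalize e2 : al + l - 1 / 2 + m = d2
  generalize e4 : al + 0 - 1 / 2 + m = d4
  generalize e12 : 2 * (al + m + l) - 1 = d12
  generalize e13 : 2 * (al + m + l) + 1 = d13
  generalize e9 : al + m = d9
  generalize e16 : m + 1 = d16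
  have f2 : d2 ≠ 0 := by rw [← e2]; intro h; linarith
  have f4 : d4 ≠ 0 := by rw [← e4]; intro h; linarith
  have f7 : d7 ≠ 0 := by rw [← e7]; intro h; linarith
  have f8 : d8 ≠ 0 := by rw [← e8]; intro h; linarith
  have f9 : d9 ≠ 0 := by rw [← e9]; intro h; linarith
  have f12 : d12 ≠ 0 := by rw [← e12]; intro h; linarith
  have f13 : d13 ≠ 0 := by rw [← e13]; intro h; linarith
  have f16 : d16 ≠ 0 := by rw [← e16]; intro h; linarith
  field_simp
  subst e2 e4 e7 e8 e9 e12 e13 e16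
  ring

/-- **The Legendre-edge identity** (level `0`): `λ_x λ_{y+1}(μ(h_x,h_{y+1}) - h_{y+1}) = λ_{x+1} λ_y (μ(h_{x+1},h_y) - h_{x+1})`,
`ℓ = x + y + 1`. [folklore] -/
theorem spin_legendre_identity (al : ℝ) (x y : ℕ) :
    legendreLam x * legendreLam (y + 1) *
        (spinMu al ((x : ℝ) + y + 1) (al + x) (al + (y + 1)) - (al + (y + 1))) =
      legendreLam (x + 1) * legendreLam y *
        (spinMu al ((x : ℝ) + y + 1) (al + (x + 1)) (al + y) - (al + (x + 1))) := by
  rw [legendreLam_succ x, legendreLam_succ y]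
  unfold spinMu
  generalize e1 : 2 * (x : ℝ) + 2 = d1
  generalize e2 : 2 * (y : ℝ) + 2 = d2
  have f1 : d1 ≠ 0 := by rw [← e1]; positivity
  have f2 : d2 ≠ 0 := by rw [← e2]; positivity
  field_simp
  subst e1 e2
  ring

end SpinIdentities

end Literature.MathematicalPhysics.QuantumFieldTheory.ConformalBootstrap3D
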